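/-
Copyright: the b2b-balaban T⁴-continuum CRUX team, row NE7b OWNER lineage `t4-ne7b-p1` (gen 137). Project licence.
-/
import Summits.QuantumFields.BalabanUV.T4Continuum.Spine.NE7b.SupBlockNextHessianMatrix
import Summits.QuantumFields.BalabanUV.T4Continuum.Spine.NE7b.SupBlockThirdLetter
import Summits.QuantumFields.BalabanUV.T4Continuum.Spine.NE7b.SupDressedStep

/-!
# THE DRESSED STEP FOR A BLOCK-LOCAL INPUT — (390)'s BLOCK TWIN: EXTRACTION + ABSORPTION, THEN (β3′)∕(β4).  For a block potential `U`
# with stability on `Y` (so `Z(ψ) = ∫e^{−U(ω+ψ)}dN(0,Γ) > 0` everywhere), ANY vector `b` and matrix `K`, and the NEXT covariance `S ≻ 0`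
# with `S⁻¹ + K ≻ 0`: for EVERY `F`,
#   `∫ Z(ψ₀+ζ)•F(ζ) dN(0,S)(ζ) = Z(ψ₀) • (c • ∫ e^{r(ζ)}•F(ζ) dN(−(S⁻¹+K)⁻¹b, (S⁻¹+K)⁻¹)(ζ))`,
#   `r(ζ) = log Z(ψ₀+ζ) − log Z(ψ₀) + ⟨b,ζ⟩ + ½ζᵀKζ`,   `c = ∫e^{−½ζᵀKζ − ⟨b,ζ⟩}dN(0,S) > 0` ((390) `dressed_step_const`, abstract),
# by the EXACT factorisation `Z(ψ₀+ζ) = Z(ψ₀)·e^{−⟨b,ζ⟩−½ζᵀKζ}·e^{r(ζ)}` ((386) `factorisation_of_logs`) and (385)'s absorption identity;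
# and THE ROAD'S CHOICE `K = K_D(ψ₀)`, `b = b_D(ψ₀)` of (404) is admissible: under (404)'s hypotheses and `S ⪯ γ′·1`, `2λγ′ < 1`,
# `S⁻¹ + K_D(ψ₀) ≻ 0` ((387) `dressed_precision_posDef` on the matrix letter `K_D + 2λ·1 ⪰ 0`) — with (408) (`r`'s cubic letter) and (409)
# (`r`'s global letter and class) the dressed step (385)–(394) RUNS ON BLOCK-LOCAL INPUTS AND RETURNS ITS OWN INPUT CLASS before rescaling
# (row NE7b, node U5c; (385)∕(386)∕(387)∕(390)∕(404)∕(406) BY NAME; [folklore])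

Cell `pub-balaban`, sub-cell `t4`, spine estimate NE7b (`T4WeightBudget.RelWeightBound`; the cell's OWN estimate — NOT PRINTED in
[Bałaban 1983–89], NOT PROVED).  Crux-route work under `Spine/NE7b/` by the row OWNER (`t4-ne7b-p1` gen 137, file (410)) under FREEZE
(0)'s crux-prover clause, on gen 136's SCOPING-d8 DECISION (d8′) («the literal re-run of (386)∕(389)∕(391)∕(394) with `U` for `Σw`» —
here (390)); NOTHING of Bałaban's is named as a Lean object, valued or asserted; no `T4Continuum/Support` leaf typed; no `def`, no notation
(`K_D` WRITTEN OUT as in (404)); zero `sorry`.  Imports (BY NAME): the OWNER's (404) `…SupBlockNextHessianMatrix`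
(`blockHessianMatrix_letters`), (406) `…SupBlockThirdLetter` (`blockZ_pos`), (390) `…SupDressedStep` and through it (385)
(`absorption_integral_neg`), (386) (`factorisation_of_logs`), (387) (`dressed_precision_posDef`).

WHAT IS PROVED ([folklore]; `Z(ψ) = ∫e^{−U(ω+ψ)}dN(0,Γ)`):
* §1 `block_Z_pos` (`Z(ψ) > 0` at every `ψ`), **`block_next_factor_factorisation`** (for EVERY `ζ, b, K`:
  `Z(ψ₀+ζ) = Z(ψ₀)·(e^{−½ζᵀKζ − ⟨b,ζ⟩}·e^{r(ζ)})`);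
* §2 THE END **`block_dressed_step`** (the display, for EVERY `F : ℝ^ι → G`); the one number `c` and its closed form are (390)'s
  `dressed_step_const` verbatim (abstract in `b, K, S` — not restated);
* §3 THE ROAD'S CHOICE **`block_road_dressed_precision_posDef`**: under (404)'s hypotheses (over `N(0,M⁻¹)`, `2λ ≤ m`) and a next covariance
  `S ≻ 0`, `S ⪯ γ′·1`, `0 < γ′`, `2λγ′ < 1`:  `S⁻¹ + K_D(ψ₀) ≻ 0`; §4 toy.

HONEST (what this is NOT).  An exact identity plus one discharged positivity; `r`'s letters are (408) (cubic, on small fields) and (409) (global,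
second order) — their constants are NOT shown to contract: that, with blocking∕rescaling, is the renormalisation group proper ((β4)) and
remains LOCATED, not done; the dressed covariance is not finite range ((393)∕(395): decay letters; (β3′) the polymer expansion on a decaying
covariance); scalar skeleton ((A3), NC-NE7b-α UNRULED); nothing of Bałaban's asserted.  BY-NAME EFFECT ON THE WALL: NONE.  NE7b NOT PRINTED ∕
NOT PROVED; spine PROVED 0∕9; rung (B)+1 — the programme's measures remain FINITE-torus statements; NOT the mass gap, NOT Clay.  HONEST
DEPENDENCY: continuum YM on T⁴ ⇐ BetaPertH ∧ nine spine estimates (0∕9 proved); BetaPertH ⇐ (D1) ∧ (D4) ∧ CAP+tail; G-an2-4 gates asym, D1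
and NE2∕3∕4.
-/

set_option autoImplicit false
set_option maxSynthPendingDepth 2

noncomputable section

namespace Summit.QuantumFields.BalabanUV.T4Continuum.NE7b.SupBlockDressedStep

open MeasureTheory ProbabilityTheory Finset Real Matrix
open scoped BigOperators
open SupBlockNextHessianMatrix (blockHessianMatrix_letters)
open SupBlockThirdLetter (blockZ_pos)
open SupGaussianQuadraticAbsorption (absorption_integral_neg)
open SupQuadraticExtractionLine (factorisation_of_logs)
open SupDressedCovarianceLetters (dressed_precision_posDef)

variable {ι : Type} [Fintype ι] [DecidableEq ι]

section Road

variable {Γ : Matrix ι ι ℝ} {γop : ℝ} {U : EuclideanSpace ℝ ι → ℝ} {U' : EuclideanSpace ℝ ι → EuclideanSpace ℝ ι →L[ℝ] ℝ} {κ₀ τ δ θ : ℝ}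

/-! ## §1. Positivity and the exact factorisation of the next factor -/

/-- `Z(ψ) > 0` at every background `ψ` ((406) `blockZ_pos` at `t = 0`). [folklore] -/
theorem block_Z_pos (hΓ : Γ.PosSemidef) (hΓop : (γop • (1 : Matrix ι ι ℝ) - Γ).PosSemidef) (Y : Finset ι)
    (hUd : ∀ φ : EuclideanSpace ℝ ι, HasFDerivAt U (U' φ) φ) (hκ₀ : 0 ≤ κ₀) (hτ : 0 < τ) (hδ : 0 < δ) (hθ0 : 0 < θ) (hθ1 : θ < 1)
    (hκθ : (2 * κ₀ * (1 + τ) + 4 * δ) * γop ≤ θ) (hstab : ∀ φ : EuclideanSpace ℝ ι, -(κ₀ * ∑ x ∈ Y, φ x ^ 2) ≤ U φ) (ψ : EuclideanSpace ℝ ι) :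
    0 < (∫ ω : EuclideanSpace ℝ ι, exp (-U (ω + ψ)) ∂(multivariateGaussian 0 Γ)) := by
  have h := (blockZ_pos hΓ hΓop Y hUd hκ₀ hτ hδ hθ0 hθ1 hκθ hstab ψ ψ 0).2
  simpa only [zero_smul, add_zero] using h

/-- **THE EXACT FACTORISATION OF THE NEXT FACTOR OF A BLOCK INPUT**: for EVERY `ζ`, vector `b` and matrix `K`,
`Z(ψ₀+ζ) = Z(ψ₀)·(e^{−½ζᵀKζ − ⟨b,ζ⟩}·e^{r(ζ)})`, `r(ζ) = log Z(ψ₀+ζ) − log Z(ψ₀) + ⟨b,ζ⟩ + ½ζᵀKζ`. [folklore] -/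
theorem block_next_factor_factorisation (hΓ : Γ.PosSemidef) (hΓop : (γop • (1 : Matrix ι ι ℝ) - Γ).PosSemidef) (Y : Finset ι)
    (hUd : ∀ φ : EuclideanSpace ℝ ι, HasFDerivAt U (U' φ) φ) (hκ₀ : 0 ≤ κ₀) (hτ : 0 < τ) (hδ : 0 < δ) (hθ0 : 0 < θ) (hθ1 : θ < 1)
    (hκθ : (2 * κ₀ * (1 + τ) + 4 * δ) * γop ≤ θ) (hstab : ∀ φ : EuclideanSpace ℝ ι, -(κ₀ * ∑ x ∈ Y, φ x ^ 2) ≤ U φ) (ψ₀ ζ : EuclideanSpace ℝ ι) (b : ι → ℝ) (K : Matrix ι ι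
        ℝ) :
    (∫ ω : EuclideanSpace ℝ ι, exp (-U (ω + (ψ₀ + ζ))) ∂(multivariateGaussian 0 Γ)) =
      (∫ ω : EuclideanSpace ℝ ι, exp (-U (ω + ψ₀)) ∂(multivariateGaussian 0 Γ)) *
        (Real.exp (-((WithLp.ofLp ζ) ⬝ᵥ K *ᵥ (WithLp.ofLp ζ)) / 2 - (b ⬝ᵥ (WithLp.ofLp ζ))) * Real.exp (Real.log (∫ ω : EuclideanSpace ℝ ι, exp (-U (ω + (ψ₀ + ζ)))
            ∂(multivariateGaussian 0 Γ)) - Real.log (∫ ω : EuclideanSpace ℝ ι, exp (-U (ω + ψ₀)) ∂(multivariateGaussian 0 Γ)) + (b ⬝ᵥ (WithLp.ofLp ζ)) + ((WithLp.ofLp ζ) ⬝ᵥ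
            K *ᵥ (WithLp.ofLp ζ)) / 2)) := by
  have hZ0 := block_Z_pos hΓ hΓop Y hUd hκ₀ hτ hδ hθ0 hθ1 hκθ hstab ψ₀
  have hZ1 := block_Z_pos hΓ hΓop Y hUd hκ₀ hτ hδ hθ0 hθ1 hκθ hstab (ψ₀ + ζ)
  have h := factorisation_of_logs hZ0 hZ1 (-(b ⬝ᵥ (WithLp.ofLp ζ))) (-((WithLp.ofLp ζ) ⬝ᵥ K *ᵥ (WithLp.ofLp ζ)))
  rw [show -(b ⬝ᵥ (WithLp.ofLp ζ)) + -((WithLp.ofLp ζ) ⬝ᵥ K *ᵥ (WithLp.ofLp ζ)) / 2 = -((WithLp.ofLp ζ) ⬝ᵥ K *ᵥ (WithLp.ofLp ζ)) / 2 - (b ⬝ᵥ (WithLp.ofLp ζ)) from by ring,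
    show Real.log (∫ ω : EuclideanSpace ℝ ι, exp (-U (ω + (ψ₀ + ζ))) ∂(multivariateGaussian 0 Γ)) - Real.log (∫ ω : EuclideanSpace ℝ ι, exp (-U (ω + ψ₀))
        ∂(multivariateGaussian 0 Γ)) - -(b ⬝ᵥ (WithLp.ofLp ζ)) - -((WithLp.ofLp ζ) ⬝ᵥ K *ᵥ (WithLp.ofLp ζ)) / 2 = (Real.log (∫ ω : EuclideanSpace ℝ ι, exp (-U (ω + (ψ₀ +
        ζ))) ∂(multivariateGaussian 0 Γ)) - Real.log (∫ ω : EuclideanSpace ℝ ι, exp (-U (ω + ψ₀)) ∂(multivariateGaussian 0 Γ)) + (b ⬝ᵥ (WithLp.ofLp ζ)) + ((WithLp.ofLp ζ)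
        ⬝ᵥ K *ᵥ (WithLp.ofLp ζ)) / 2) from by ring, mul_assoc] at h
  exact h

/-! ## §2. THE END: the dressed step for a block input -/

variable {G : Type*} [NormedAddCommGroup G] [NormedSpace ℝ G]

/-- **THE DRESSED STEP FOR A BLOCK-LOCAL INPUT.**  This step's data as in `block_Z_pos` (`Γ ⪰ 0`, `Γ ⪯ γ_op·1`, a differentiable block
potential `U` with stability on `Y`, the regulator margin); ANY vector `b` and matrix `K`; the NEXT covariance `S ≻ 0` with `S⁻¹ + K ≻ 0` ⟹
for EVERY `F : ℝ^ι → G`: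
`∫ Z(ψ₀+ζ)•F(ζ) dN(0,S) = Z(ψ₀) • ((∫e^{−½ζᵀKζ − ⟨b,ζ⟩}dN(0,S)) • ∫ e^{r(ζ)}•F(ζ) dN(−(S⁻¹+K)⁻¹b, (S⁻¹+K)⁻¹))`. [folklore] -/
theorem block_dressed_step (hΓ : Γ.PosSemidef) (hΓop : (γop • (1 : Matrix ι ι ℝ) - Γ).PosSemidef) (Y : Finset ι)
    (hUd : ∀ φ : EuclideanSpace ℝ ι, HasFDerivAt U (U' φ) φ) (hκ₀ : 0 ≤ κ₀) (hτ : 0 < τ) (hδ : 0 < δ) (hθ0 : 0 < θ) (hθ1 : θ < 1)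
    (hκθ : (2 * κ₀ * (1 + τ) + 4 * δ) * γop ≤ θ) (hstab : ∀ φ : EuclideanSpace ℝ ι, -(κ₀ * ∑ x ∈ Y, φ x ^ 2) ≤ U φ) (ψ₀ : EuclideanSpace ℝ ι) (b : ι → ℝ) (K : Matrix ι ι ℝ)
    {S : Matrix ι ι ℝ} (hS : S.PosDef) (hQ : (S⁻¹ + K).PosDef) (F : EuclideanSpace ℝ ι → G) :
    ∫ ζ : EuclideanSpace ℝ ι, (∫ ω : EuclideanSpace ℝ ι, exp (-U (ω + (ψ₀ + ζ))) ∂(multivariateGaussian 0 Γ)) • F ζ ∂(multivariateGaussian 0 S) =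
      (∫ ω : EuclideanSpace ℝ ι, exp (-U (ω + ψ₀)) ∂(multivariateGaussian 0 Γ)) •
        ((∫ ζ : EuclideanSpace ℝ ι, Real.exp (-((WithLp.ofLp ζ) ⬝ᵥ K *ᵥ (WithLp.ofLp ζ)) / 2 - (b ⬝ᵥ (WithLp.ofLp ζ))) ∂(multivariateGaussian 0 S)) •
          ∫ ζ : EuclideanSpace ℝ ι, Real.exp (Real.log (∫ ω : EuclideanSpace ℝ ι, exp (-U (ω + (ψ₀ + ζ))) ∂(multivariateGaussian 0 Γ)) - Real.log (∫ ω : EuclideanSpace ℝ ι,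
              exp (-U (ω + ψ₀)) ∂(multivariateGaussian 0 Γ)) + (b ⬝ᵥ (WithLp.ofLp ζ)) + ((WithLp.ofLp ζ) ⬝ᵥ K *ᵥ (WithLp.ofLp ζ)) / 2) • F ζ
            ∂(multivariateGaussian (WithLp.toLp 2 (-((S⁻¹ + K)⁻¹ *ᵥ b))) (S⁻¹ + K)⁻¹)) := by
  have hfac := fun ζ : EuclideanSpace ℝ ι => block_next_factor_factorisation hΓ hΓop Y hUd hκ₀ hτ hδ hθ0 hθ1 hκθ hstab ψ₀ ζ b K
  have habs := absorption_integral_neg hS K hQ b (fun ζ : EuclideanSpace ℝ ι => Real.exp (Real.log (∫ ω : EuclideanSpace ℝ ι, exp (-U (ω + (ψ₀ + ζ))) ∂(multivariateGaussian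
      0 Γ)) - Real.log (∫ ω : EuclideanSpace ℝ ι, exp (-U (ω + ψ₀)) ∂(multivariateGaussian 0 Γ)) + (b ⬝ᵥ (WithLp.ofLp ζ)) + ((WithLp.ofLp ζ) ⬝ᵥ K *ᵥ (WithLp.ofLp ζ)) / 2) •
      F ζ)
  rw [← habs, ← integral_smul]
  refine integral_congr_ae (ae_of_all _ fun ζ => ?_)
  dsimp only
  nth_rewrite 1 [hfac ζ]
  rw [smul_smul, smul_smul]
  congr 1
  ring

end Road

/-! ## §3. THE ROAD'S CHOICE: `S⁻¹ + K_D(ψ₀) ≻ 0` from the block matrix letters -/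

section Choice

variable {M : Matrix ι ι ℝ} {γop m lam Λ : ℝ} {U : EuclideanSpace ℝ ι → ℝ} {U' : EuclideanSpace ℝ ι → EuclideanSpace ℝ ι →L[ℝ] ℝ}
  {U'' : EuclideanSpace ℝ ι → EuclideanSpace ℝ ι →L[ℝ] EuclideanSpace ℝ ι →L[ℝ] ℝ} {κ₀ κ₁ κ₂ a τ δ θ : ℝ}

/-- **THE DRESSED PRECISION OF THE ROAD IS POSITIVE DEFINITE FOR A BLOCK INPUT**: under (404)'s hypotheses (this step over `N(0,M⁻¹)`,
`M ≻ 0` of floor `m`, `C²` block `U` with the block letters, the two-point upper letter `Λ ≥ 0` on `Y`, the secant lower letter `λ ≥ 0`,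
`2λ ≤ m`, the regulator margins) and a NEXT covariance `S ≻ 0` with `γ′·1 − S ⪰ 0`, `0 < γ′`, `2λ·γ′ < 1`:  `S⁻¹ + K_D(ψ₀) ≻ 0` — the
hypothesis `hQ` of `block_dressed_step` for the road's choice `K = K_D(ψ₀)`. [folklore] -/
theorem block_road_dressed_precision_posDef (hM : M.PosDef) (hfl : ∀ z : ι → ℝ, m * ∑ i, z i ^ 2 ≤ z ⬝ᵥ (M *ᵥ z)) (hΓop : (γop • (1 : Matrix ι ι ℝ) - M⁻¹).PosSemidef) (Y :
    Finset ι)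
    (hUd : ∀ φ : EuclideanSpace ℝ ι, HasFDerivAt U (U' φ) φ) (hU'd : ∀ φ : EuclideanSpace ℝ ι, HasFDerivAt U' (U'' φ) φ)
    (hU''c : Continuous U'') (hκ₀ : 0 ≤ κ₀) (hκ₁ : 0 ≤ κ₁) (ha : 0 ≤ a) (hκ₂ : 0 ≤ κ₂) (hτ : 0 < τ) (hδ : 0 < δ) (hθ0 : 0 < θ)
    (hθ1 : θ < 1) (hκθ : (2 * κ₀ * (1 + τ) + 4 * δ) * γop ≤ θ) (hstab : ∀ φ : EuclideanSpace ℝ ι, -(κ₀ * ∑ x ∈ Y, φ x ^ 2) ≤ U φ)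
    (hU'b : ∀ φ : EuclideanSpace ℝ ι, ‖U' φ‖ ≤ κ₁ * (a + ∑ x ∈ Y, φ x ^ 2)) (hU''b : ∀ φ : EuclideanSpace ℝ ι, ‖U'' φ‖ ≤ κ₂) (hΛ : 0 ≤ Λ)
    (hwup : ∀ φ φ' : EuclideanSpace ℝ ι, U φ' ≤ U φ + U' φ (φ' - φ) + Λ / 2 * ∑ x ∈ Y, (φ' x - φ x) ^ 2) (hlam : 0 ≤ lam)
    (hUsec : ∀ s : ℝ, 0 ≤ s → s ≤ 1 → ∀ a b : EuclideanSpace ℝ ι,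
      U ((1 - s) • a + s • b) - lam / 2 * (s * (1 - s)) * ∑ i, (a i - b i) ^ 2 ≤ (1 - s) * U a + s * U b)
    (hm : 2 * lam ≤ m) (ψ₀ : EuclideanSpace ℝ ι)
    {S : Matrix ι ι ℝ} {γ' : ℝ} (hS : S.PosDef) (hSγ : (γ' • (1 : Matrix ι ι ℝ) - S).PosSemidef) (hγ' : 0 < γ')
    (hsmall : 2 * lam * γ' < 1) :
    (S⁻¹ + (Matrix.of fun x y : ι => (((∫ ω : EuclideanSpace ℝ ι, exp (-U (ω + ψ₀)) ∂(multivariateGaussian 0 M⁻¹))⁻¹ • (∫ ω : EuclideanSpace ℝ ι, exp (-U (ω + ψ₀)) • (U''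
        (ω + ψ₀) - (U' (ω + ψ₀)).smulRight (U' (ω + ψ₀))) ∂(multivariateGaussian 0 M⁻¹)) + (((∫ ω : EuclideanSpace ℝ ι, exp (-U (ω + ψ₀)) ∂(multivariateGaussian 0 M⁻¹)) ^
        2)⁻¹ • ∫ ω : EuclideanSpace ℝ ι, exp (-U (ω + ψ₀)) • U' (ω + ψ₀) ∂(multivariateGaussian 0 M⁻¹)).smulRight (∫ ω : EuclideanSpace ℝ ι, exp (-U (ω + ψ₀)) • U' (ω + ψ₀)
        ∂(multivariateGaussian 0 M⁻¹))) (EuclideanSpace.single x (1 : ℝ)) (EuclideanSpace.single y (1 : ℝ)) + ((∫ ω : EuclideanSpace ℝ ι, exp (-U (ω + ψ₀))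
        ∂(multivariateGaussian 0 M⁻¹))⁻¹ • (∫ ω : EuclideanSpace ℝ ι, exp (-U (ω + ψ₀)) • (U'' (ω + ψ₀) - (U' (ω + ψ₀)).smulRight (U' (ω + ψ₀))) ∂(multivariateGaussian 0
        M⁻¹)) + (((∫ ω : EuclideanSpace ℝ ι, exp (-U (ω + ψ₀)) ∂(multivariateGaussian 0 M⁻¹)) ^ 2)⁻¹ • ∫ ω : EuclideanSpace ℝ ι, exp (-U (ω + ψ₀)) • U' (ω + ψ₀)
        ∂(multivariateGaussian 0 M⁻¹)).smulRight (∫ ω : EuclideanSpace ℝ ι, exp (-U (ω + ψ₀)) • U' (ω + ψ₀) ∂(multivariateGaussian 0 M⁻¹))) (EuclideanSpace.single y (1 :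
        ℝ)) (EuclideanSpace.single x (1 : ℝ))) / 2)).PosDef := by
  obtain ⟨-, hK, -⟩ := blockHessianMatrix_letters hM hfl hΓop Y hUd hU'd hU''c hκ₀ hκ₁ ha hκ₂ hτ hδ hθ0 hθ1 hκθ hstab hU'b hU''b hΛ hwup hlam hUsec hm ψ₀
  exact dressed_precision_posDef hS hSγ hγ' hK hsmall

end Choice

/-! ## §4. Toy -/

/-- Toy (§1's algebra): `−q∕2 − ℓ` with `ℓ = −β`, `q = −κ` is `κ∕2 + β`. -/
example (β κ : ℝ) : -(-κ) / 2 - -β = κ / 2 + β := by ring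

end Summit.QuantumFields.BalabanUV.T4Continuum.NE7b.SupBlockDressedStep
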